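import Mathlib
import Literature.Computability.AlgebraicComplexity.PIProof
import Literature.Computability.AlgebraicComplexity.BurgisserTransferProofs

/-!
# Route ProofCarryingSymmetry — crux `RestorationQP`, line `registered`: T′ from boundedness of `P_c(ℂ)`

The conditional rung of stub T′ (`stub_invarianceProvableQP'`: a diagonally `S_n`-invariant family
computed by polynomial-size Hrubeš–Tzameret circuits `PICircuit` has quasi-polynomial circuits all
of whose invariance identities `C ∘ σ = C` have quasi-polynomial `P_c(ℂ)`-proofs).  T′ follows
from the standard conjecture of algebraic proof complexity — boundedness of `P_c(ℂ)` on pairs of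
circuits computing the same polynomial — in either form:

* `invarianceProvableQP'_of_pcQuasipolyBounded`: if every true identity `Ĉ₁ = Ĉ₂` between
  circuits on the `n²` matrix variables has a `P_c(ℂ)`-proof of size
  `2 ^ ((log₂ (|C₁| + |C₂| + n) + c) ^ c)`, then T′ holds — with the GIVEN polynomial-size
  circuits: `(C ∘ σ)^ = Ĉ ∘ σ = Ĉ` by invariance (`PICircuit.eval_rename`), `|C ∘ σ| = |C|`
  (`PICircuit.size_rename`), and quasi-polynomial bookkeeping (`PCBounded.qp_proof_absorb`, using
  `add_two_le_two_pow_log` of `Literature.….BurgisserTransferProofs`);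
* `invarianceProvableQP'_of_pcPolyBounded`: the same from polynomial boundedness
  (`(|C₁| + |C₂| + n + 2) ^ c`), a special case (`PCBounded.poly_le_qp`).

Whether `P_c(ℂ)` is (quasi-)polynomially bounded is the central open problem of algebraic proof
complexity (HrubesTzameret2009 §1); this file only records the implication.  Everything proved;
no named facts.
-/

-- single-problem summit: `Summit.ValiantsHypothesis.ValiantsHypothesis.…` is the namespace by design (D-0017)
set_option linter.dupNamespace false

namespace Summit.ValiantsHypothesis.ValiantsHypothesis.Theorems

open Literature.Computability.AlgebraicComplexity

namespace PCBounded

/-! ### Quasi-polynomial bookkeeping -/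

/-- A polynomial bound is a power of two with exponent linear in `log₂ n`:
`(n + 2) ^ c₀ ≤ 2 ^ ((log₂ n + 2) c₀)` (from `add_two_le_two_pow_log` of the Bürgisser-transfer
file). [folklore] -/
theorem pow_le_two_pow_log_mul (n c₀ : ℕ) : (n + 2) ^ c₀ ≤ 2 ^ ((Nat.log 2 n + 2) * c₀) := by
  rw [pow_mul]
  exact Nat.pow_le_pow_left (add_two_le_two_pow_log n) _

/-- Polynomial is quasi-polynomial: `(m + 2) ^ c ≤ 2 ^ ((log₂ m + (c + 2)) ^ (c + 2))`. [folklore] -/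
theorem poly_le_qp (c m : ℕ) : (m + 2) ^ c ≤ 2 ^ ((Nat.log 2 m + (c + 2)) ^ (c + 2)) := by
  refine (pow_le_two_pow_log_mul m c).trans (Nat.pow_le_pow_right (by norm_num) ?_)
  generalize Nat.log 2 m = L
  calc (L + 2) * c ≤ (L + (c + 2)) * (L + (c + 2)) := Nat.mul_le_mul (by omega) (by omega)
    _ = (L + (c + 2)) ^ 2 := (sq _).symm
    _ ≤ (L + (c + 2)) ^ (c + 2) := Nat.pow_le_pow_right (by omega) (by omega)

/-- Quasi-polynomial bookkeeping of the conditional rung: for `s ≤ (n + 2) ^ c₀`, both `s` and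
`2 ^ ((log₂ (s + s + n) + c) ^ c)` are at most `2 ^ ((log₂ n + c') ^ c')`, where
`c' = 3c + c₀ + 3`. [folklore] -/
theorem qp_proof_absorb (c c₀ : ℕ) : ∃ c' : ℕ, ∀ n s : ℕ, s ≤ (n + 2) ^ c₀ →
    s ≤ 2 ^ ((Nat.log 2 n + c') ^ c') ∧
      2 ^ ((Nat.log 2 (s + s + n) + c) ^ c) ≤ 2 ^ ((Nat.log 2 n + c') ^ c') := by
  refine ⟨3 * c + c₀ + 3, fun n s hs => ?_⟩
  have hn : n < 2 ^ (Nat.log 2 n + 1) := Nat.lt_pow_succ_log_self Nat.one_lt_two n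
  have hs' : s ≤ 2 ^ ((Nat.log 2 n + 2) * c₀) := hs.trans (pow_le_two_pow_log_mul n c₀)
  -- `s + s + n ≤ 2 ^ ((L + 2) c₀ + L + 2)`, hence `log₂ (s + s + n) ≤ (L + 2) c₀ + L + 2`
  have hS : s + s + n ≤ 2 ^ ((Nat.log 2 n + 2) * c₀ + Nat.log 2 n + 2) := by
    have h1 : 2 ^ ((Nat.log 2 n + 2) * c₀) ≤ 2 ^ ((Nat.log 2 n + 2) * c₀ + Nat.log 2 n) :=
      Nat.pow_le_pow_right (by norm_num) (by omega)
    have h2 : 2 ^ (Nat.log 2 n + 1) ≤ 2 ^ ((Nat.log 2 n + 2) * c₀ + Nat.log 2 n + 1) :=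
      Nat.pow_le_pow_right (by norm_num) (by omega)
    have h3 : 2 ^ ((Nat.log 2 n + 2) * c₀ + Nat.log 2 n + 2) =
        2 ^ ((Nat.log 2 n + 2) * c₀ + Nat.log 2 n) * 4 := by
      rw [pow_add]; norm_num
    have h4 : 2 ^ ((Nat.log 2 n + 2) * c₀ + Nat.log 2 n + 1) =
        2 ^ ((Nat.log 2 n + 2) * c₀ + Nat.log 2 n) * 2 := by
      rw [pow_succ]
    omega
  have hlog : Nat.log 2 (s + s + n) ≤ (Nat.log 2 n + 2) * c₀ + Nat.log 2 n + 2 :=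
    (Nat.log_mono_right hS).trans_eq (Nat.log_pow Nat.one_lt_two _)
  generalize Nat.log 2 n = L at hs' hlog ⊢
  set B : ℕ := L + (3 * c + c₀ + 3) with hB
  have hB1 : 1 ≤ B := by omega
  have hB2 : 2 ≤ B := by omega
  -- the size exponent: `(L + 2) c₀ ≤ B ^ c'`
  have hE1 : (L + 2) * c₀ ≤ B ^ (3 * c + c₀ + 3) :=
    calc (L + 2) * c₀ ≤ B * B := Nat.mul_le_mul (by omega) (by omega)
      _ = B ^ 2 := (sq B).symm
      _ ≤ B ^ (3 * c + c₀ + 3) := Nat.pow_le_pow_right hB1 (by omega)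
  -- the proof exponent: `(log₂ (s + s + n) + c) ^ c ≤ (B ^ 3) ^ c ≤ B ^ c'`
  have hE2 : (Nat.log 2 (s + s + n) + c) ^ c ≤ B ^ (3 * c + c₀ + 3) := by
    have h5 : Nat.log 2 (s + s + n) + c ≤ B ^ 3 :=
      calc Nat.log 2 (s + s + n) + c ≤ (L + 2) * c₀ + (L + 2 + c) := by omega
        _ ≤ B * B + B := Nat.add_le_add (Nat.mul_le_mul (by omega) (by omega)) (by omega)
        _ ≤ B * B + B * B := Nat.add_le_add_left (Nat.le_mul_of_pos_right B hB1) _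
        _ = 2 * (B * B) := by ring
        _ ≤ B * (B * B) := Nat.mul_le_mul_right _ hB2
        _ = B ^ 3 := by ring
    calc (Nat.log 2 (s + s + n) + c) ^ c ≤ (B ^ 3) ^ c := Nat.pow_le_pow_left h5 _
      _ = B ^ (3 * c) := by rw [← pow_mul]
      _ ≤ B ^ (3 * c + c₀ + 3) := Nat.pow_le_pow_right hB1 (by omega)
  exact ⟨hs'.trans (Nat.pow_le_pow_right (by norm_num) hE1), Nat.pow_le_pow_right (by norm_num) hE2⟩

end PCBounded

/-- **T′ from quasi-polynomial boundedness of `P_c(ℂ)`** (conditional rung of stub T′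
`stub_invarianceProvableQP'`, crux `RestorationQP`, line `registered`).  If every identity
`Ĉ₁ = Ĉ₂` between straight-line circuits on the matrix variables `Fin n × Fin n` has a
`P_c(ℂ)`-proof of size quasi-polynomial in `|C₁| + |C₂| + n`, then every diagonally
`S_n`-invariant family computed by polynomial-size circuits has (the same) circuits all of whose
invariance identities `C ∘ σ = C` have quasi-polynomial `P_c(ℂ)`-proofs: `(C ∘ σ)^ = Ĉ ∘ σ = Ĉ`
by invariance.  The hypothesis is the central open problem of algebraic proof complexity
(Hrubeš–Tzameret): no super-polynomial `P_c` lower bound is known for any family of identities.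
[folklore] -/
theorem invarianceProvableQP'_of_pcQuasipolyBounded : (∃ c : ℕ, ∀ (n : ℕ) (C₁ C₂ : PICircuit ℂ (Fin n × Fin n)), C₁.eval = C₂.eval → HasPCProofOfSize C₁ C₂ (2 ^ ((Nat.log 2 (C₁.size + C₂.size + n) + c) ^ c))) → ∀ f : (n : ℕ) → MvPolynomial (Fin n × Fin n) ℂ, (∀ (n : ℕ) (σ : Equiv.Perm (Fin n)), MvPolynomial.rename (fun x : Fin n × Fin n => σ • x) (f n) = f n) → (∃ c : ℕ, ∀ n : ℕ, (f n).totalDegree ≤ (n + 2) ^ c ∧ ∃ C : PICircuit ℂ (Fin n × Fin n), C.eval = f n ∧ C.size ≤ (n + 2) ^ c) → ∃ c : ℕ, ∀ n : ℕ, ∃ C : PICircuit ℂ (Fin n × Fin n), C.eval = f n ∧ C.size ≤ 2 ^ ((Nat.log 2 n + c) ^ c) ∧ ∀ σ : Equiv.Perm (Fin n), HasPCProofOfSize (C.rename fun x : Fin n × Fin n => σ • x) C (2 ^ ((Nat.log 2 n + c) ^ c)) := by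
  rintro ⟨c, hc⟩ f hinv ⟨c₀, hc₀⟩
  obtain ⟨c', hc'⟩ := PCBounded.qp_proof_absorb c c₀
  refine ⟨c', fun n => ?_⟩
  obtain ⟨-, C, hCeval, hCsize⟩ := hc₀ n
  obtain ⟨hsize, hproof⟩ := hc' n C.size hCsize
  refine ⟨C, hCeval, hsize, fun σ => ?_⟩
  have heval : (C.rename fun x : Fin n × Fin n => σ • x).eval = C.eval := by
    rw [PICircuit.eval_rename, hCeval, hinv n σ]
  have h := hc n _ C heval
  rw [PICircuit.size_rename] at h
  exact h.mono hproof

/-- **T′ from polynomial boundedness of `P_c(ℂ)`** (conditional rung of stub T′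
`stub_invarianceProvableQP'`, crux `RestorationQP`, line `registered`): the same conclusion from
`P_c(ℂ)`-proofs of size polynomial in `|C₁| + |C₂| + n` for all identities `Ĉ₁ = Ĉ₂` — a
polynomial bound is a quasi-polynomial one (`PCBounded.poly_le_qp`). [folklore] -/
theorem invarianceProvableQP'_of_pcPolyBounded : (∃ c : ℕ, ∀ (n : ℕ) (C₁ C₂ : PICircuit ℂ (Fin n × Fin n)), C₁.eval = C₂.eval → HasPCProofOfSize C₁ C₂ ((C₁.size + C₂.size + n + 2) ^ c)) → ∀ f : (n : ℕ) → MvPolynomial (Fin n × Fin n) ℂ, (∀ (n : ℕ) (σ : Equiv.Perm (Fin n)), MvPolynomial.rename (fun x : Fin n × Fin n => σ • x) (f n) = f n) → (∃ c : ℕ, ∀ n : ℕ, (f n).totalDegree ≤ (n + 2) ^ c ∧ ∃ C : PICircuit ℂ (Fin n × Fin n), C.eval = f n ∧ C.size ≤ (n + 2) ^ c) → ∃ c : ℕ, ∀ n : ℕ, ∃ C : PICircuit ℂ (Fin n × Fin n), C.eval = f n ∧ C.size ≤ 2 ^ ((Nat.log 2 n + c) ^ c) ∧ ∀ σ : Equiv.Perm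 (Fin n), HasPCProofOfSize (C.rename fun x : Fin n × Fin n => σ • x) C (2 ^ ((Nat.log 2 n + c) ^ c)) := by
  rintro ⟨c, hc⟩
  exact invarianceProvableQP'_of_pcQuasipolyBounded
    ⟨c + 2, fun n C₁ C₂ h => (hc n C₁ C₂ h).mono (PCBounded.poly_le_qp c _)⟩

end Summit.ValiantsHypothesis.ValiantsHypothesis.Theorems
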